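import Literature.Computability.Cryptography.VanDamSeroussiCubicBlockState
import HarnessLib

/-!
# The quantum block of the cubic Gauss-sum experiment, IV: the output state collected by label

Topic `Literature/Computability/Cryptography`; sequel of `VanDamSeroussiCubicBlockState.lean`. The final
state of one block, `blockCirc d |0…0⟩`, is split into its GOOD part — a superposition of the labels
`tri x_b γ (P = u)` (`b` the control, `γ` the test read-out, `u < N` the moved register) with the
explicit amplitudes `amp d b γ u` of the Hadamard test between the idle branch and the coset branch
(van Dam–Seroussi 2002, §4, proof of Thm. 1: `(|0⟩|∅⟩ + e^{iγ}|1⟩|χ⟩)/√2` followed by the phase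
read-out of Fact 2) — and its JUNK part, carried by flagged labels (`Φ_eq`, `goodPart_eq`,
`junkPart_flag`).

Everything here is proved; no named fact is introduced.

## References

* W. van Dam, G. Seroussi, arXiv:quant-ph/0207131 (2002), §3.1 Fact 2, §4 Thm. 1 (proof) [VanDamSeroussi2002].
* A. Yu. Kitaev, arXiv:quant-ph/9511026 (1995), §3 (Remark 8, Lemma 8) [Kitaev1995].
-/

noncomputable section

namespace Literature.Computability.Cryptography

namespace VanDamSeroussi

namespace CubicBlock

open _root_.Computability Complexity QuantumComplexity QuantumComplexity.RevSim QuantumComplexity.RevClean Kitaev1995 Matrix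
  Finset

namespace Layout

variable (Λ : Layout)

/-! ### Regrouping a superposition by the value of a bounded index -/

omit Λ in
/-- `Σ_a F(a) • g(v a) = Σ_{u<N} (Σ_a [v a = u] F a) • g u` when `v < N` on the range. [folklore] -/
theorem sum_smul_regroup {α V : Type*} [AddCommMonoid V] [Module ℂ V] (S : Finset α) (F : α → ℂ) (v : α → ℕ) {N : ℕ}
    (hv : ∀ a ∈ S, v a < N) (g : ℕ → V) :
    ∑ a ∈ S, F a • g (v a) = ∑ u ∈ range N, (∑ a ∈ S, if v a = u then F a else 0) • g u := by
  simp_rw [Finset.sum_smul, ite_smul, zero_smul]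
  rw [Finset.sum_comm]
  refine sum_congr rfl fun a ha => ?_
  rw [Finset.sum_ite_eq, if_pos (mem_range.2 (hv a ha))]

/-! ### The amplitudes -/

/-- The weighted exponent of a test string. [cite: Kitaev1995, §3 Lemma 10] -/
def Ey (y : QReg Λ.k) : ℕ := weightedExp Λ.Bper (List.ofFn y)

/-- The value moved to `P`: `(yv + E(y)) mod N`. [folklore] -/
def uOf (yv : ℕ) (y : QReg Λ.k) : ℕ := (yv + Λ.Ey y) % Λ.Nmod

/-- `uOf < N`. [folklore] -/
theorem uOf_lt (yv : ℕ) (y : QReg Λ.k) : Λ.uOf yv y < Λ.Nmod := Nat.mod_lt _ (by have := Λ.size_facts.1; omega)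

/-- The coefficient of Kitaev's circuit: `(-i)^{#σ∧y} (-1)^{y·γ}`. [cite: Kitaev1995, §3 Remark 8] -/
def sS (y γ : QReg Λ.k) : ℂ := sPhase Λ.σ y * ySign y γ

/-- **The unnormalised amplitude of the idle branch** at read-out `γ` and moved value `u`.
[cite: VanDamSeroussi2002, §4 Thm. 1 (proof)] -/
def a₀ (d : Data) (γ : QReg Λ.k) (u : ℕ) : ℂ :=
  ∑ jv ∈ range (2 ^ Λ.lam), ∑ y : QReg Λ.k, if Λ.uOf (jv * d.p) y = u then Λ.sS y γ else 0

/-- **The unnormalised amplitude of the coset branch** at read-out `γ` and moved value `u`.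
[cite: VanDamSeroussi2002, §4 Thm. 1 (proof)] -/
def a₁ (d : Data) (γ : QReg Λ.k) (u : ℕ) : ℂ :=
  ∑ s ∈ Λ.goodS d, ∑ jv ∈ range (2 ^ Λ.lam), ∑ y : QReg Λ.k, if Λ.uOf (s + jv * d.p) y = u then Λ.sS y γ else 0

/-- The phase put on the coset branch by the read-out: `-i` for a sine block. [cite: Kitaev1995, §3 Remark 8] -/
def ph (d : Data) : ℂ := if d.im then -Complex.I else 1

/-- Normalisation of the idle branch. [folklore] -/
def c₀ : ℂ := invSqrt2 * invSqrt2 ^ Λ.lam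
/-- Normalisation of the coset branch. [folklore] -/
def c₁ : ℂ := invSqrt2 * invSqrt2 ^ Λ.n * invSqrt2 ^ Λ.lam
/-- Normalisation of Kitaev's circuit. [folklore] -/
def K : ℂ := invSqrt2 ^ Λ.k * invSqrt2 ^ Λ.k

/-- **The amplitude of the good label `(b, γ, u)`**: the Hadamard test of the two branches.
[cite: VanDamSeroussi2002, §3.1 Fact 2, §4 Thm. 1 (proof)] -/
def amp (d : Data) (b : Bool) (γ : QReg Λ.k) (u : ℕ) : ℂ :=
  invSqrt2 * Λ.K * (Λ.c₀ * Λ.a₀ d γ u + (if b then (-1 : ℂ) else 1) * ph d * Λ.c₁ * Λ.a₁ d γ u)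

/-- The first part of a good label with control `b`. [folklore] -/
def xb (d : Data) (b : Bool) : QReg Λ.n₁ := if b then Λ.x₁ d else Λ.x₀ d

/-- **The good labels**: control `b`, tests `γ`, `Y` clean, `P = u`. [folklore] -/
def gl (d : Data) (b : Bool) (γ : QReg Λ.k) (u : ℕ) : QReg Λ.Wd := tri (Λ.xb d b) γ (Λ.yp 0 u)

/-! ### The read-out on the good labels -/

/-- The control wire of `x₀` is clear, of `x₁` is set. [folklore] -/
theorem xb_c (d : Data) : Λ.x₀ d ⟨Λ.c, Λ.c_lt_n₁⟩ = false ∧ Λ.x₁ d ⟨Λ.c, Λ.c_lt_n₁⟩ = true :=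
  ⟨Λ.x₀_of_lt_cs Λ.lt_cs_facts.1 Λ.tau_lt_c _, by rw [x₁_def, xc, Function.update_self]⟩

/-- Setting the control of `x₀` gives `x₁`, clearing the control of `x₁` gives `x₀`. [folklore] -/
theorem update_xb (d : Data) :
    Function.update (Λ.x₀ d) ⟨Λ.c, Λ.c_lt_n₁⟩ true = Λ.x₁ d ∧ Function.update (Λ.x₁ d) ⟨Λ.c, Λ.c_lt_n₁⟩ false = Λ.x₀ d ∧
      Function.update (Λ.x₀ d) ⟨Λ.c, Λ.c_lt_n₁⟩ false = Λ.x₀ d ∧ Function.update (Λ.x₁ d) ⟨Λ.c, Λ.c_lt_n₁⟩ true = Λ.x₁ d := by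
  refine ⟨rfl, ?_, Function.update_eq_self_iff.2 (Λ.xb_c d).1.symm, Function.update_eq_self_iff.2 (Λ.xb_c d).2.symm⟩
  rw [x₁_def, xc, Function.update_idem, Function.update_eq_self_iff]
  exact (Λ.xb_c d).1.symm

/-- **The read-out of a label of the idle branch.** [cite: VanDamSeroussi2002, §3.1 Fact 2] -/
theorem read_x₀ (d : Data) (γ : QReg Λ.k) (ρ : QReg (Λ.kap + Λ.kap)) :
    Λ.readCirc.toMatrix 0 *ᵥ basisState (tri (Λ.x₀ d) γ ρ) =
      (invSqrt2 : ℂ) • (basisState (tri (Λ.x₀ d) γ ρ) + basisState (tri (Λ.x₁ d) γ ρ)) := by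
  obtain ⟨h01, -, h00, -⟩ := Λ.update_xb d
  rw [Λ.readCirc_mulVec, Λ.tri_fin_of_lt _ _ _ Λ.c_lt_n₁, (Λ.xb_c d).1, Λ.update_tri_fin _ _ _ Λ.c_lt_n₁,
    Λ.update_tri_fin _ _ _ Λ.c_lt_n₁, h01, h00]
  simp

/-- **The read-out of a label of the coset branch.** [cite: VanDamSeroussi2002, §3.1 Fact 2] -/
theorem read_x₁ (d : Data) (γ : QReg Λ.k) (ρ : QReg (Λ.kap + Λ.kap)) :
    Λ.readCirc.toMatrix 0 *ᵥ basisState (tri (Λ.x₁ d) γ ρ) =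
      (ph d * invSqrt2) • (basisState (tri (Λ.x₀ d) γ ρ) - basisState (tri (Λ.x₁ d) γ ρ)) := by
  obtain ⟨-, h10, -, h11⟩ := Λ.update_xb d
  have hτ : tri (Λ.x₁ d) γ ρ (Λ.fin Λ.tau) = d.im := by
    rw [Λ.tri_fin_of_lt _ _ _ Λ.tau_lt_n₁, Λ.x₁_of_ne_c (Nat.ne_of_lt Λ.tau_lt_c)]; exact Λ.x₀_tau (d := d)
  rw [Λ.readCirc_mulVec, hτ, Λ.tri_fin_of_lt _ _ _ Λ.c_lt_n₁, (Λ.xb_c d).2, Λ.update_tri_fin _ _ _ Λ.c_lt_n₁,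
    Λ.update_tri_fin _ _ _ Λ.c_lt_n₁, h10, h11, ph, sub_eq_add_neg]
  simp

/-! ### The two branches through the eigenvalue measurement and the read-out -/

/-- The bound `2^λ p ≤ N/… `: every `s + jp` with `s < 2ⁿ`, `j < 2^λ` is below `N`. [folklore] -/
theorem lt_Nmod {d : Data} (hd : Λ.DataOK d) {s jv : ℕ} (hs : s < 2 ^ Λ.n) (hjv : jv < 2 ^ Λ.lam) : s + jv * d.p < Λ.Nmod := by
  have h1 : jv * d.p < 2 ^ Λ.lam * 2 ^ Λ.n := Nat.mul_lt_mul_of_lt_of_le hjv hd.p_lt.le (by positivity)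
  have h2 : 2 ^ Λ.lam * 2 ^ Λ.n = 2 ^ (Λ.lam + Λ.n) := (pow_add 2 _ _).symm
  have h3 : 2 ^ Λ.n ≤ 2 ^ (Λ.lam + Λ.n) := Nat.pow_le_pow_right (by norm_num) (by omega)
  have h4 : 2 ^ (Λ.lam + Λ.n) + 2 ^ (Λ.lam + Λ.n) ≤ Λ.Nmod := by
    rw [← two_mul, ← pow_succ']; exact Nat.pow_le_pow_right (by norm_num) (by unfold kap; omega)
  omega

/-- **A label of the idle branch through the measurement and the read-out.** [cite: VanDamSeroussi2002, §4 Thm. 1 (proof)] -/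
theorem branch₀_vec {d : Data} (hd : Λ.DataOK d) {jv : ℕ} (hjv : jv < 2 ^ Λ.lam) :
    Λ.readCirc.toMatrix 0 *ᵥ (Λ.peCirc.toMatrix 0 *ᵥ basisState (tri (Λ.x₀ d) (fun _ : Fin Λ.k => false) (Λ.yp (jv * d.p) 0))) =
      (Λ.K * invSqrt2) • ∑ y : QReg Λ.k, ∑ γ : QReg Λ.k, Λ.sS y γ •
        (basisState (Λ.gl d false γ (Λ.uOf (jv * d.p) y)) + basisState (Λ.gl d true γ (Λ.uOf (jv * d.p) y))) := by
  have hyv : jv * d.p < Λ.Nmod := by have := Λ.lt_Nmod hd (s := 0) (by positivity) hjv; omega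
  rw [Λ.peCirc_mulVec_good _ Λ.x₀_good hyv, Matrix.mulVec_smul, Matrix.mulVec_sum,
    show (invSqrt2 : ℂ) ^ Λ.k * invSqrt2 ^ Λ.k = Λ.K from rfl, mul_smul]
  congr 1
  rw [Finset.smul_sum]
  refine sum_congr rfl fun y _ => ?_
  rw [Matrix.mulVec_sum, Finset.smul_sum]
  refine sum_congr rfl fun γ _ => ?_
  rw [Matrix.mulVec_smul, Λ.read_x₀, smul_comm, sS, gl, gl, xb, xb, if_neg Bool.false_ne_true, if_pos rfl, uOf, Ey]

/-- **A label of the coset branch through the measurement and the read-out.** [cite: VanDamSeroussi2002, §4 Thm. 1 (proof)] -/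
theorem branch₁_vec {d : Data} (hd : Λ.DataOK d) {s : ℕ} (hs : s < 2 ^ Λ.n) {jv : ℕ} (hjv : jv < 2 ^ Λ.lam) :
    Λ.readCirc.toMatrix 0 *ᵥ (Λ.peCirc.toMatrix 0 *ᵥ basisState (tri (Λ.x₁ d) (fun _ : Fin Λ.k => false) (Λ.yp (s + jv * d.p) 0))) =
      (Λ.K * (ph d * invSqrt2)) • ∑ y : QReg Λ.k, ∑ γ : QReg Λ.k, Λ.sS y γ •
        (basisState (Λ.gl d false γ (Λ.uOf (s + jv * d.p) y)) - basisState (Λ.gl d true γ (Λ.uOf (s + jv * d.p) y))) := by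
  rw [Λ.peCirc_mulVec_good _ Λ.x₁_good (Λ.lt_Nmod hd hs hjv), Matrix.mulVec_smul, Matrix.mulVec_sum,
    show (invSqrt2 : ℂ) ^ Λ.k * invSqrt2 ^ Λ.k = Λ.K from rfl, mul_smul]
  congr 1
  rw [Finset.smul_sum]
  refine sum_congr rfl fun y _ => ?_
  rw [Matrix.mulVec_sum, Finset.smul_sum]
  refine sum_congr rfl fun γ _ => ?_
  rw [Matrix.mulVec_smul, Λ.read_x₁, smul_comm, sS, gl, gl, xb, xb, if_neg Bool.false_ne_true, if_pos rfl, uOf, Ey]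

/-! ### Collecting the good part by label -/

/-- Regrouping the idle branch by the moved value. [folklore] -/
theorem regroup₀ (d : Data) (g : QReg Λ.k → ℕ → (QReg Λ.Wd → ℂ)) :
    ∑ jv ∈ range (2 ^ Λ.lam), ∑ y : QReg Λ.k, ∑ γ : QReg Λ.k, Λ.sS y γ • g γ (Λ.uOf (jv * d.p) y) =
      ∑ γ : QReg Λ.k, ∑ u ∈ range Λ.Nmod, Λ.a₀ d γ u • g γ u := by
  rw [show (∑ jv ∈ range (2 ^ Λ.lam), ∑ y : QReg Λ.k, ∑ γ : QReg Λ.k, Λ.sS y γ • g γ (Λ.uOf (jv * d.p) y)) =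
      ∑ jv ∈ range (2 ^ Λ.lam), ∑ γ : QReg Λ.k, ∑ y : QReg Λ.k, Λ.sS y γ • g γ (Λ.uOf (jv * d.p) y) from
      sum_congr rfl fun _ _ => Finset.sum_comm, Finset.sum_comm]
  refine sum_congr rfl fun γ _ => ?_
  rw [← Finset.sum_product' (range (2 ^ Λ.lam)) univ fun jv y => Λ.sS y γ • g γ (Λ.uOf (jv * d.p) y),
    sum_smul_regroup _ _ _ (fun q _ => Λ.uOf_lt _ _)]
  refine sum_congr rfl fun u _ => ?_
  rw [a₀, Finset.sum_product]

/-- Regrouping the coset branch by the moved value. [folklore] -/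
theorem regroup₁ (d : Data) (g : QReg Λ.k → ℕ → (QReg Λ.Wd → ℂ)) :
    ∑ s ∈ Λ.goodS d, ∑ jv ∈ range (2 ^ Λ.lam), ∑ y : QReg Λ.k, ∑ γ : QReg Λ.k, Λ.sS y γ • g γ (Λ.uOf (s + jv * d.p) y) =
      ∑ γ : QReg Λ.k, ∑ u ∈ range Λ.Nmod, Λ.a₁ d γ u • g γ u := by
  have h : ∀ s ∈ Λ.goodS d, ∑ jv ∈ range (2 ^ Λ.lam), ∑ y : QReg Λ.k, ∑ γ : QReg Λ.k, Λ.sS y γ • g γ (Λ.uOf (s + jv * d.p) y) =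
      ∑ γ : QReg Λ.k, ∑ u ∈ range Λ.Nmod,
        (∑ jv ∈ range (2 ^ Λ.lam), ∑ y : QReg Λ.k, if Λ.uOf (s + jv * d.p) y = u then Λ.sS y γ else 0) • g γ u := by
    intro s _
    rw [show (∑ jv ∈ range (2 ^ Λ.lam), ∑ y : QReg Λ.k, ∑ γ : QReg Λ.k, Λ.sS y γ • g γ (Λ.uOf (s + jv * d.p) y)) =
        ∑ jv ∈ range (2 ^ Λ.lam), ∑ γ : QReg Λ.k, ∑ y : QReg Λ.k, Λ.sS y γ • g γ (Λ.uOf (s + jv * d.p) y) from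
        sum_congr rfl fun _ _ => Finset.sum_comm, Finset.sum_comm]
    refine sum_congr rfl fun γ _ => ?_
    rw [← Finset.sum_product' (range (2 ^ Λ.lam)) univ fun jv y => Λ.sS y γ • g γ (Λ.uOf (s + jv * d.p) y),
      sum_smul_regroup _ _ _ (fun q _ => Λ.uOf_lt _ _)]
    refine sum_congr rfl fun u _ => ?_
    rw [Finset.sum_product]
  rw [sum_congr rfl h, Finset.sum_comm]
  refine sum_congr rfl fun γ _ => ?_
  rw [Finset.sum_comm]
  refine sum_congr rfl fun u _ => ?_
  rw [a₁, Finset.sum_smul]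

/-- **The good part of the output state**: the two branches through the measurement and the read-out.
[cite: VanDamSeroussi2002, §4 Thm. 1 (proof)] -/
def goodVec (d : Data) : QReg Λ.Wd → ℂ :=
  Λ.c₀ • ∑ jv ∈ range (2 ^ Λ.lam), Λ.readCirc.toMatrix 0 *ᵥ (Λ.peCirc.toMatrix 0 *ᵥ
    basisState (tri (Λ.x₀ d) (fun _ : Fin Λ.k => false) (Λ.yp (jv * d.p) 0))) +
  Λ.c₁ • ∑ s ∈ Λ.goodS d, ∑ jv ∈ range (2 ^ Λ.lam), Λ.readCirc.toMatrix 0 *ᵥ (Λ.peCirc.toMatrix 0 *ᵥ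
    basisState (tri (Λ.x₁ d) (fun _ : Fin Λ.k => false) (Λ.yp (s + jv * d.p) 0)))

/-- **The good part collected by label.** [cite: VanDamSeroussi2002, §3.1 Fact 2, §4 Thm. 1 (proof)] -/
theorem goodVec_eq {d : Data} (hd : Λ.DataOK d) :
    Λ.goodVec d = ∑ γ : QReg Λ.k, ∑ u ∈ range Λ.Nmod,
      (Λ.amp d false γ u • basisState (Λ.gl d false γ u) + Λ.amp d true γ u • basisState (Λ.gl d true γ u)) := by
  have h0 : ∑ jv ∈ range (2 ^ Λ.lam), Λ.readCirc.toMatrix 0 *ᵥ (Λ.peCirc.toMatrix 0 *ᵥ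
      basisState (tri (Λ.x₀ d) (fun _ : Fin Λ.k => false) (Λ.yp (jv * d.p) 0))) =
      (Λ.K * invSqrt2) • ∑ γ : QReg Λ.k, ∑ u ∈ range Λ.Nmod,
        Λ.a₀ d γ u • (basisState (Λ.gl d false γ u) + basisState (Λ.gl d true γ u)) := by
    rw [← Λ.regroup₀ d fun γ u => basisState (Λ.gl d false γ u) + basisState (Λ.gl d true γ u), Finset.smul_sum]
    exact sum_congr rfl fun jv hjv => Λ.branch₀_vec hd (mem_range.1 hjv)
  have h1 : ∑ s ∈ Λ.goodS d, ∑ jv ∈ range (2 ^ Λ.lam), Λ.readCirc.toMatrix 0 *ᵥ (Λ.peCirc.toMatrix 0 *ᵥ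
      basisState (tri (Λ.x₁ d) (fun _ : Fin Λ.k => false) (Λ.yp (s + jv * d.p) 0))) =
      (Λ.K * (ph d * invSqrt2)) • ∑ γ : QReg Λ.k, ∑ u ∈ range Λ.Nmod,
        Λ.a₁ d γ u • (basisState (Λ.gl d false γ u) - basisState (Λ.gl d true γ u)) := by
    rw [← Λ.regroup₁ d fun γ u => basisState (Λ.gl d false γ u) - basisState (Λ.gl d true γ u), Finset.smul_sum]
    refine sum_congr rfl fun s hs => ?_
    rw [Finset.smul_sum]
    exact sum_congr rfl fun jv hjv => Λ.branch₁_vec hd (mem_range.1 (mem_filter.1 hs).1) (mem_range.1 hjv)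
  rw [goodVec, h0, h1, smul_smul, smul_smul, Finset.smul_sum, Finset.smul_sum, ← sum_add_distrib]
  refine sum_congr rfl fun γ _ => ?_
  rw [Finset.smul_sum, Finset.smul_sum, ← sum_add_distrib]
  refine sum_congr rfl fun u _ => ?_
  simp only [amp, smul_add, smul_sub, smul_smul, Bool.false_eq_true, if_false, if_true]
  module

/-! ### The junk part and the whole output state -/

/-- The repetition stage does not touch the control. [folklore] -/
theorem rmap_fin_c (x : QReg Λ.n₁) (jv : ℕ) : Λ.rmap x jv (Λ.fin Λ.c) = x ⟨Λ.c, Λ.c_lt_n₁⟩ := by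
  obtain ⟨hccs, -, hfcs, -, hXf, hcsas⟩ := Λ.lt_cs_facts
  have has := Λ.as_le_n₁; have hW := Λ.n₁_le_Wd
  unfold rmap
  rw [PXor.clEval_ops_of_ne Λ.geom₃ _ _ fun j hj h => ?_, PXor.clEval_ops_of_ne Λ.geom₂ _ _ fun j hj h => ?_,
    Λ.tri_fin_of_lt _ _ _ Λ.c_lt_n₁, Λ.setReg_of_not _ _ (by simp only; unfold J c; omega)]
  · have := congrArg Fin.val h
    rw [CleanXor.tgt, fin, val_finOf_of_lt _ (by omega), val_finOf_of_lt _ (Λ.Y_lt_Wd hj)] at this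
    have := Λ.n₁_le_Y j; omega
  · have := congrArg Fin.val h
    have htlt : Λ.tXJ j < Λ.n₁ := by
      unfold tXJ; split_ifs with h'
      · have := Λ.X_lt_as h'; omega
      · have := Λ.J_lt_as (i := j - Λ.n) (by omega); omega
    rw [CleanXor.tgt, fin, val_finOf_of_lt _ (by omega), val_finOf_of_lt _ (by omega)] at this
    revert this; unfold tXJ; split_ifs <;> simp only [X, J, c] <;> omega

/-- The repetition stage does not touch the tests. [folklore] -/
theorem rmap_coinWire (x : QReg Λ.n₁) (jv : ℕ) (j : Fin Λ.k) : Λ.rmap x jv (coinWire Λ.n₁ Λ.k _ j) = false := by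
  have has := Λ.as_le_n₁; have hW := Λ.n₁_le_Wd
  unfold rmap
  rw [PXor.clEval_ops_of_ne Λ.geom₃ _ _ fun i hi h => ?_, PXor.clEval_ops_of_ne Λ.geom₂ _ _ fun i hi h => ?_, tri_coinWire]
  · have := congrArg Fin.val h
    rw [CleanXor.tgt, val_coinWire, val_finOf_of_lt _ (Λ.Y_lt_Wd hi)] at this
    simp only [Y] at this; have := j.isLt; omega
  · have := congrArg Fin.val h
    have htlt : Λ.tXJ i < Λ.n₁ := by
      unfold tXJ; split_ifs with h'
      · have := Λ.X_lt_as h'; omega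
      · have := Λ.J_lt_as (i := i - Λ.n) (by omega); omega
    rw [CleanXor.tgt, val_coinWire, val_finOf_of_lt _ (by omega)] at this
    omega

/-- **The junk part of the output state**: the flagged labels through the measurement and the read-out. [folklore] -/
def junkVec (d : Data) : QReg Λ.Wd → ℂ :=
  Λ.c₁ • ∑ s ∈ Λ.junkS d, ∑ jv ∈ range (2 ^ Λ.lam), Λ.readCirc.toMatrix 0 *ᵥ (Λ.peCirc.toMatrix 0 *ᵥ basisState (Λ.rmap (Λ.xJ d s) jv))

/-- **The output state of the block in the component `d`** (coins `c' = d.cp`, `τ = d.im`): the stages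
after the constants-and-coins stage applied to the component label. [cite: VanDamSeroussi2002, §4 Thm. 1] -/
def Φ (d : Data) : QReg Λ.Wd → ℂ :=
  Λ.readCirc.toMatrix 0 *ᵥ (Λ.peCirc.toMatrix 0 *ᵥ (Λ.repCirc.toMatrix 0 *ᵥ (Λ.prepCirc.toMatrix 0 *ᵥ
    basisState (tri (Λ.x₀ d) (fun _ : Fin Λ.k => false) (fun _ : Fin (Λ.kap + Λ.kap) => false)))))

/-- **The output state is the good part plus the junk part.** [cite: VanDamSeroussi2002, §4 Thm. 1 (proof)] -/
theorem Φ_eq {d : Data} (hd : Λ.DataOK d) (hp : 0 < d.p) : Λ.Φ d = Λ.goodVec d + Λ.junkVec d := by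
  rw [Φ, Λ.blockPre_mulVec hd hp,
    Matrix.mulVec_add, Matrix.mulVec_add, Matrix.mulVec_add, Matrix.mulVec_add, Matrix.mulVec_smul, Matrix.mulVec_smul,
    Matrix.mulVec_smul, Matrix.mulVec_smul, Matrix.mulVec_smul, Matrix.mulVec_smul, Matrix.mulVec_sum, Matrix.mulVec_sum,
    Matrix.mulVec_sum, Matrix.mulVec_sum, Matrix.mulVec_sum, Matrix.mulVec_sum, goodVec, junkVec, c₀, c₁]
  simp only [Matrix.mulVec_sum, add_assoc]

/-! ### The junk part is carried by flagged labels with the control set -/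

/-- A junk label before the measurement: tests clean, control and flag set. [folklore] -/
theorem rmap_xJ_parts (d : Data) (s jv : ℕ) :
    Λ.rmap (Λ.xJ d s) jv = tri (fun i => Λ.rmap (Λ.xJ d s) jv (Fin.castAdd _ i)) (fun _ : Fin Λ.k => false)
      (fun l => Λ.rmap (Λ.xJ d s) jv (Fin.natAdd Λ.n₁ (Fin.natAdd Λ.k l))) ∧
    Λ.rmap (Λ.xJ d s) jv (Λ.fin Λ.c) = true ∧ Λ.rmap (Λ.xJ d s) jv (Λ.fin Λ.f) = true := by
  obtain ⟨hccs, hXcs, hfcs, -, hXf, -⟩ := Λ.lt_cs_facts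
  refine ⟨?_, ?_, Λ.rmap_xJ_flag (d := d) s jv⟩
  · conv_lhs => rw [← tri_parts (Λ.rmap (Λ.xJ d s) jv)]
    congr 1
    funext j
    exact Λ.rmap_coinWire _ _ j
  · rw [Λ.rmap_fin_c, xJ, xf, Function.update_of_ne (fun h => by have := Fin.mk.inj_iff.1 h; unfold c f at this; omega), xX,
      Λ.setReg_of_not _ _ (by simp only; unfold c X; omega)]
    exact (Λ.xb_c d).2

/-- **The measured junk label keeps the control and the flag set.** [folklore] -/
theorem pe_rmap_xJ_apply_ne_zero (d : Data) (s jv : ℕ) {w : QReg Λ.Wd}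
    (hw : (Λ.peCirc.toMatrix 0 *ᵥ basisState (Λ.rmap (Λ.xJ d s) jv)) w ≠ 0) : w (Λ.fin Λ.c) = true ∧ w (Λ.fin Λ.f) = true := by
  obtain ⟨hparts, hc, hf⟩ := Λ.rmap_xJ_parts d s jv
  set z := Λ.rmap (Λ.xJ d s) jv with hz
  rw [hparts, Λ.peCirc_mulVec_tri] at hw
  simp only [Pi.smul_apply, Finset.sum_apply, smul_eq_mul, basisState_apply, mul_ite, mul_one, mul_zero] at hw
  -- some term of the double sum is non-zero: `w` is one of the labels
  obtain ⟨y, -, hy⟩ := Finset.exists_ne_zero_of_sum_ne_zero (right_ne_zero_of_mul hw)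
  obtain ⟨y', -, hy'⟩ := Finset.exists_ne_zero_of_sum_ne_zero hy
  have hwl : w = tri (fun i => z (Fin.castAdd _ i)) y' (Λ.A (fun i => z (Fin.castAdd _ i)) y fun l => z (Fin.natAdd Λ.n₁ (Fin.natAdd Λ.k l))) := by
    by_contra h; exact hy' (if_neg h)
  rw [hwl, Λ.tri_fin_of_lt _ _ _ Λ.c_lt_n₁, Λ.tri_fin_of_lt _ _ _ Λ.f_lt_n₁]
  constructor
  · rw [← hc, fin, finOf_of_lt _ (by have := Λ.c_lt_n₁; have := Λ.n₁_le_Wd; omega)]; rfl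
  · rw [← hf, fin, finOf_of_lt _ (by have := Λ.f_lt_n₁; have := Λ.n₁_le_Wd; omega)]; rfl

/-- The junk part before the read-out. [folklore] -/
def ψJ (d : Data) : QReg Λ.Wd → ℂ :=
  Λ.c₁ • ∑ s ∈ Λ.junkS d, ∑ jv ∈ range (2 ^ Λ.lam), Λ.peCirc.toMatrix 0 *ᵥ basisState (Λ.rmap (Λ.xJ d s) jv)

/-- The junk part is the read-out of `ψJ`. [folklore] -/
theorem junkVec_eq (d : Data) : Λ.junkVec d = Λ.readCirc.toMatrix 0 *ᵥ Λ.ψJ d := by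
  rw [junkVec, ψJ, Matrix.mulVec_smul, Matrix.mulVec_sum]
  simp only [Matrix.mulVec_sum]

/-- **`ψJ` is carried by labels with the control and the flag set.** [folklore] -/
theorem ψJ_apply_eq_zero (d : Data) (w : QReg Λ.Wd) (hw : w (Λ.fin Λ.c) = false ∨ w (Λ.fin Λ.f) = false) : Λ.ψJ d w = 0 := by
  rw [ψJ, Pi.smul_apply, Finset.sum_apply, smul_eq_mul]
  refine mul_eq_zero_of_right _ (Finset.sum_eq_zero fun s _ => ?_)
  rw [Finset.sum_apply]
  refine Finset.sum_eq_zero fun jv _ => ?_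
  by_contra h
  obtain ⟨hc, hf⟩ := Λ.pe_rmap_xJ_apply_ne_zero d s jv h
  rcases hw with hw | hw
  · rw [hc] at hw; exact Bool.noConfusion hw
  · rw [hf] at hw; exact Bool.noConfusion hw

/-! ### The read-out of a state carried by labels with the control set -/

/-- **Reading out a state carried by `c = 1` labels**: the amplitude at `w` is, up to a phase and the
factor `1/√2`, the amplitude of `ψ` at `w` with the control set — whatever the control of `w`.
[cite: VanDamSeroussi2002, §3.1 Fact 2] -/
theorem norm_read_apply (ψ : QReg Λ.Wd → ℂ) (hψ : ∀ w, w (Λ.fin Λ.c) = false → ψ w = 0) (w : QReg Λ.Wd) :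
    ‖(Λ.readCirc.toMatrix 0 *ᵥ ψ) w‖ = ‖(invSqrt2 : ℂ)‖ * ‖ψ (Function.update w (Λ.fin Λ.c) true)‖ := by
  classical
  set z₀ := Function.update w (Λ.fin Λ.c) true with hz₀
  have hz₀c : z₀ (Λ.fin Λ.c) = true := by rw [hz₀, Function.update_self]
  have hph : ‖(if z₀ (Λ.fin Λ.tau) ∧ z₀ (Λ.fin Λ.c) then -Complex.I else (1 : ℂ))‖ = 1 := by split_ifs <;> simp
  have hzfix : ∀ z : QReg Λ.Wd, z (Λ.fin Λ.c) = true → Function.update z (Λ.fin Λ.c) true = z := fun z hz =>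
    Function.update_eq_self_iff.2 hz.symm
  -- the value of the read-out at `w`
  have hval : (Λ.readCirc.toMatrix 0 *ᵥ ψ) w =
      ψ z₀ * (((if z₀ (Λ.fin Λ.tau) ∧ z₀ (Λ.fin Λ.c) then -Complex.I else 1) * invSqrt2) *
        (if w (Λ.fin Λ.c) = true then (-1 : ℂ) else 1)) := by
    conv_lhs => rw [state_eq_sum_smul_basisState ψ, Matrix.mulVec_sum]
    simp_rw [Matrix.mulVec_smul, Λ.readCirc_mulVec]
    rw [Finset.sum_apply, Finset.sum_eq_single z₀]
    · have hu0 : Function.update z₀ (Λ.fin Λ.c) false = Function.update w (Λ.fin Λ.c) false := by rw [hz₀, Function.update_idem]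
      have hu1 : Function.update z₀ (Λ.fin Λ.c) true = z₀ := by rw [hz₀, Function.update_idem]
      simp only [Pi.smul_apply, Pi.add_apply, smul_eq_mul, basisState_apply, hu0, hu1, hz₀c, if_true]
      cases hwc : w (Λ.fin Λ.c)
      · have e1 : w = Function.update w (Λ.fin Λ.c) false := (Function.update_eq_self_iff.2 hwc.symm).symm
        have e2 : w ≠ z₀ := fun h => by rw [h] at hwc; rw [hz₀c] at hwc; exact Bool.noConfusion hwc
        rw [if_pos e1, if_neg e2, if_neg Bool.false_ne_true]; ring
      · have e1 : w ≠ Function.update w (Λ.fin Λ.c) false := fun h => by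
          have := congrFun h (Λ.fin Λ.c); rw [Function.update_self, hwc] at this; exact Bool.noConfusion this
        have e2 : w = z₀ := by rw [hz₀, hzfix w hwc]
        rw [if_neg e1, if_pos e2, if_pos rfl]; ring
    · intro z _ hz
      by_cases hzc : z (Λ.fin Λ.c) = false
      · rw [hψ z hzc, zero_smul, Pi.zero_apply]
      · have hzc' : z (Λ.fin Λ.c) = true := by simpa using hzc
        have h1 : w ≠ Function.update z (Λ.fin Λ.c) false := fun h => hz (by rw [hz₀, h, Function.update_idem, hzfix z hzc'])
        have h2 : w ≠ Function.update z (Λ.fin Λ.c) true := fun h => hz (by rw [hz₀, h, Function.update_idem, hzfix z hzc'])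
        simp only [Pi.smul_apply, Pi.add_apply, smul_eq_mul, basisState_apply, if_neg h1, if_neg h2, mul_zero, add_zero]
    · exact fun h => absurd (Finset.mem_univ _) h
  rw [hval, norm_mul, norm_mul, norm_mul, hph, one_mul, mul_comm]
  congr 1
  split_ifs <;> simp

/-! ### Born sums of a superposition of distinct labels -/

omit Λ in
/-- **Born weights of a superposition of pairwise distinct basis labels**: the probability of an event
is the sum of `|α_i|²` over the labels in the event. [cite: NielsenChuang2010, §2.2.5] -/
theorem sum_filter_norm_sq_superposition {ι : Type*} {W : ℕ} (I : Finset ι) (L : ι → QReg W) (hL : Set.InjOn L I)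
    (α : ι → ℂ) (P : QReg W → Prop) [DecidablePred P] :
    ∑ w ∈ univ.filter P, ‖(∑ i ∈ I, α i • basisState (L i)) w‖ ^ 2 = ∑ i ∈ I.filter (fun i => P (L i)), ‖α i‖ ^ 2 := by
  classical
  set v : QReg W → ℂ := ∑ i ∈ I, α i • basisState (L i) with hv
  have hvL : ∀ i ∈ I, v (L i) = α i := fun i hi => by
    rw [hv, Finset.sum_apply, Finset.sum_eq_single i (fun i' hi' hne => ?_) (fun h => absurd hi h)]
    · simp [basisState_apply]
    · rw [Pi.smul_apply, basisState_apply, if_neg (fun h => hne (hL hi' hi h.symm)), smul_zero]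
  have hv0 : ∀ w, w ∉ I.image L → v w = 0 := fun w hw => by
    rw [hv, Finset.sum_apply]
    refine Finset.sum_eq_zero fun i hi => ?_
    rw [Pi.smul_apply, basisState_apply, if_neg (fun h => hw (Finset.mem_image.2 ⟨i, hi, h.symm⟩)), smul_zero]
  rw [← Finset.sum_filter_add_sum_filter_not (univ.filter P) (fun w => w ∈ I.image L),
    Finset.sum_eq_zero (s := (univ.filter P).filter fun w => w ∉ I.image L) (fun w hw => by
      rw [hv0 w (Finset.mem_filter.1 hw).2, norm_zero, zero_pow two_ne_zero]), add_zero,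
    show (univ.filter P).filter (fun w => w ∈ I.image L) = (I.filter fun i => P (L i)).image L by
      ext w
      simp only [Finset.mem_filter, Finset.mem_univ, true_and, Finset.mem_image]
      constructor
      · rintro ⟨hP, i, hi, rfl⟩; exact ⟨i, ⟨hi, hP⟩, rfl⟩
      · rintro ⟨i, ⟨hi, hP⟩, rfl⟩; exact ⟨hP, i, hi, rfl⟩,
    Finset.sum_image fun i hi i' hi' h => hL (Finset.mem_filter.1 hi).1 (Finset.mem_filter.1 hi').1 h]
  exact Finset.sum_congr rfl fun i hi => by rw [hvL i (Finset.mem_filter.1 hi).1]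

omit Λ in
/-- `‖a + b‖² = ‖a‖² + ‖b‖²` when one of them vanishes. [folklore] -/
theorem norm_sq_add_of_zero {a b : ℂ} (h : a = 0 ∨ b = 0) : ‖a + b‖ ^ 2 = ‖a‖ ^ 2 + ‖b‖ ^ 2 := by
  rcases h with rfl | rfl <;> simp

/-! ### The statistics of one block -/

/-- The test read-out of an output label. [folklore] -/
def testsOf (w : QReg Λ.Wd) : QReg Λ.k := fun j => w (coinWire Λ.n₁ Λ.k _ j)

/-- The control is not a test wire. [folklore] -/
theorem coinWire_ne_fin_c (j : Fin Λ.k) : coinWire Λ.n₁ Λ.k (Λ.kap + Λ.kap) j ≠ Λ.fin Λ.c := fun h => by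
  have := congrArg Fin.val h
  rw [val_coinWire, fin, val_finOf_of_lt _ (by have := Λ.c_lt_n₁; have := Λ.n₁_le_Wd; omega)] at this
  have := Λ.c_lt_n₁; omega

/-- Updating the control does not change the tests. [folklore] -/
theorem testsOf_update (w : QReg Λ.Wd) (b : Bool) : Λ.testsOf (Function.update w (Λ.fin Λ.c) b) = Λ.testsOf w := by
  funext j; exact Function.update_of_ne (Λ.coinWire_ne_fin_c j) _ _

/-- **The probability of (control `= b`, tests in `T`) at the output of the block.** [cite: NielsenChuang2010, §2.2.5] -/
def Pb (d : Data) (b : Bool) (T : QReg Λ.k → Prop) [DecidablePred T] : ℝ :=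
  ∑ w ∈ univ.filter (fun w : QReg Λ.Wd => w (Λ.fin Λ.c) = b ∧ T (Λ.testsOf w)), ‖Λ.Φ d w‖ ^ 2

/-- **The junk contributes equally to both values of the control.** [cite: VanDamSeroussi2002, §4 Thm. 1 (proof)] -/
theorem junk_symm (d : Data) (T : QReg Λ.k → Prop) [DecidablePred T] :
    ∑ w ∈ univ.filter (fun w : QReg Λ.Wd => w (Λ.fin Λ.c) = false ∧ T (Λ.testsOf w)), ‖Λ.junkVec d w‖ ^ 2 =
      ∑ w ∈ univ.filter (fun w : QReg Λ.Wd => w (Λ.fin Λ.c) = true ∧ T (Λ.testsOf w)), ‖Λ.junkVec d w‖ ^ 2 := by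
  have hψ : ∀ w : QReg Λ.Wd, w (Λ.fin Λ.c) = false → Λ.ψJ d w = 0 := fun w hw => Λ.ψJ_apply_eq_zero d w (Or.inl hw)
  have hval : ∀ w : QReg Λ.Wd, ‖Λ.junkVec d w‖ ^ 2 = ‖(invSqrt2 : ℂ)‖ ^ 2 * ‖Λ.ψJ d (Function.update w (Λ.fin Λ.c) true)‖ ^ 2 := by
    intro w; rw [Λ.junkVec_eq, Λ.norm_read_apply _ hψ, mul_pow]
  refine Finset.sum_nbij' (fun w => Function.update w (Λ.fin Λ.c) true) (fun w => Function.update w (Λ.fin Λ.c) false)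
    (fun w hw => ?_) (fun w hw => ?_) (fun w hw => ?_) (fun w hw => ?_) (fun w hw => ?_)
  · simp only [Finset.mem_filter, Finset.mem_univ, true_and] at hw ⊢
    exact ⟨Function.update_self _ _ _, by rw [Λ.testsOf_update]; exact hw.2⟩
  · simp only [Finset.mem_filter, Finset.mem_univ, true_and] at hw ⊢
    exact ⟨Function.update_self _ _ _, by rw [Λ.testsOf_update]; exact hw.2⟩
  · simp only [Finset.mem_filter, Finset.mem_univ, true_and] at hw
    rw [Function.update_idem, Function.update_eq_self_iff]; exact hw.1.symm
  · simp only [Finset.mem_filter, Finset.mem_univ, true_and] at hw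
    rw [Function.update_idem, Function.update_eq_self_iff]; exact hw.1.symm
  · rw [hval, hval, Function.update_idem]

/-- Good labels are distinct. [folklore] -/
theorem gl_injOn (d : Data) :
    Set.InjOn (fun q : Bool × QReg Λ.k × ℕ => Λ.gl d q.1 q.2.1 q.2.2) (↑(univ ×ˢ (univ ×ˢ range Λ.Nmod) : Finset (Bool × QReg Λ.k × ℕ))) := by
  rintro ⟨b, γ, u⟩ hq ⟨b', γ', u'⟩ hq' h
  simp only [Finset.coe_product, Set.mem_prod, Finset.coe_range, Set.mem_Iio] at hq hq'
  replace hq : u < 2 ^ Λ.kap := hq.2.2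
  replace hq' : u' < 2 ^ Λ.kap := hq'.2.2
  simp only [gl] at h
  obtain ⟨hx, hγ, hρ⟩ := tri_eq_tri_iff.1 h
  have hb : b = b' := by
    have := congrFun hx ⟨Λ.c, Λ.c_lt_n₁⟩
    revert this; cases b <;> cases b' <;> simp [xb, (Λ.xb_c d).1, (Λ.xb_c d).2]
  have hu : u = u' := by
    refine eq_of_testBit_eq_of_lt (w := Λ.kap) hq hq' fun i hi => ?_
    have := congrFun hρ ⟨Λ.kap + i, by omega⟩
    simpa [yp] using this
  subst hb; subst hγ; subst hu; rfl

/-- The control and the tests of a good label. [folklore] -/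
theorem gl_c_tests (d : Data) (b : Bool) (γ : QReg Λ.k) (u : ℕ) : Λ.gl d b γ u (Λ.fin Λ.c) = b ∧ Λ.testsOf (Λ.gl d b γ u) = γ := by
  refine ⟨?_, funext fun j => tri_coinWire _ _ _ j⟩
  rw [gl, Λ.tri_fin_of_lt _ _ _ Λ.c_lt_n₁, xb]
  cases b
  · exact (Λ.xb_c d).1
  · exact (Λ.xb_c d).2

/-- The flag of a good label is clear. [folklore] -/
theorem gl_f (d : Data) (b : Bool) (γ : QReg Λ.k) (u : ℕ) : Λ.gl d b γ u (Λ.fin Λ.f) = false := by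
  obtain ⟨hccs, -, hfcs, -, -, -⟩ := Λ.lt_cs_facts
  rw [gl, Λ.tri_fin_of_lt _ _ _ Λ.f_lt_n₁, xb]
  have h0 : Λ.x₀ d ⟨Λ.f, Λ.f_lt_n₁⟩ = false := Λ.x₀_of_lt_cs hfcs (by unfold f tau; omega) _
  cases b
  · exact h0
  · simp only [if_true]; rw [Λ.x₁_of_ne_c (by unfold c f; omega)]; exact h0

/-- **The good part as one superposition of distinct labels.** [folklore] -/
theorem goodVec_eq_sum {d : Data} (hd : Λ.DataOK d) :
    Λ.goodVec d = ∑ q ∈ (univ ×ˢ (univ ×ˢ range Λ.Nmod) : Finset (Bool × QReg Λ.k × ℕ)),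
      Λ.amp d q.1 q.2.1 q.2.2 • basisState (Λ.gl d q.1 q.2.1 q.2.2) := by
  rw [Λ.goodVec_eq hd, Finset.sum_product, Fintype.sum_bool, Finset.sum_product, Finset.sum_product, ← Finset.sum_add_distrib]
  refine Finset.sum_congr rfl fun γ _ => ?_
  rw [← Finset.sum_add_distrib]
  exact Finset.sum_congr rfl fun u _ => add_comm _ _

/-- The good part vanishes on flagged labels. [folklore] -/
theorem goodVec_apply_eq_zero {d : Data} (hd : Λ.DataOK d) (w : QReg Λ.Wd) (hw : w (Λ.fin Λ.f) = true) : Λ.goodVec d w = 0 := by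
  rw [Λ.goodVec_eq_sum hd, Finset.sum_apply]
  refine Finset.sum_eq_zero fun q _ => ?_
  rw [Pi.smul_apply, basisState_apply, if_neg (fun h => ?_), smul_zero]
  have := Λ.gl_f d q.1 q.2.1 q.2.2
  rw [← h, hw] at this
  exact Bool.noConfusion this

/-- **The good part of the probability of (control `= b`, tests in `T`).** [cite: NielsenChuang2010, §2.2.5] -/
theorem sum_good {d : Data} (hd : Λ.DataOK d) (b : Bool) (T : QReg Λ.k → Prop) [DecidablePred T] :
    ∑ w ∈ univ.filter (fun w : QReg Λ.Wd => w (Λ.fin Λ.c) = b ∧ T (Λ.testsOf w)), ‖Λ.goodVec d w‖ ^ 2 =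
      ∑ γ : QReg Λ.k, ∑ u ∈ range Λ.Nmod, if T γ then ‖Λ.amp d b γ u‖ ^ 2 else 0 := by
  classical
  rw [Λ.goodVec_eq_sum hd, sum_filter_norm_sq_superposition _ _ (Λ.gl_injOn d), Finset.sum_filter, Finset.sum_product,
    Fintype.sum_bool, Finset.sum_product, Finset.sum_product]
  have hkey : ∀ (b' : Bool) (γ : QReg Λ.k) (u : ℕ),
      (if (Λ.gl d b' γ u (Λ.fin Λ.c) = b ∧ T (Λ.testsOf (Λ.gl d b' γ u))) then ‖Λ.amp d b' γ u‖ ^ 2 else 0) =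
        if b' = b then (if T γ then ‖Λ.amp d b' γ u‖ ^ 2 else 0) else 0 := by
    intro b' γ u
    obtain ⟨hc, ht⟩ := Λ.gl_c_tests d b' γ u
    rw [hc, ht]
    by_cases hb : b' = b <;> by_cases hT : T γ <;> simp [hb, hT]
  simp only [hkey]
  cases b <;> simp

/-- **The statistics of one block.** The difference of the probabilities of reading `0` and `1` on
the control, jointly with any event `T` on the tests, is carried by the good labels alone: the junk
(flagged) part is read out with equal weights on both values of the control.
[cite: VanDamSeroussi2002, §3.1 Fact 2, §4 Thm. 1 (proof)] -/
theorem Pb_false_sub_Pb_true {d : Data} (hd : Λ.DataOK d) (hp : 0 < d.p) (T : QReg Λ.k → Prop) [DecidablePred T] :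
    Λ.Pb d false T - Λ.Pb d true T =
      ∑ γ : QReg Λ.k, ∑ u ∈ range Λ.Nmod, if T γ then ‖Λ.amp d false γ u‖ ^ 2 - ‖Λ.amp d true γ u‖ ^ 2 else 0 := by
  have hsplit : ∀ w : QReg Λ.Wd, ‖Λ.Φ d w‖ ^ 2 = ‖Λ.goodVec d w‖ ^ 2 + ‖Λ.junkVec d w‖ ^ 2 := by
    intro w
    rw [Λ.Φ_eq hd hp, Pi.add_apply]
    refine norm_sq_add_of_zero ?_
    cases hf : w (Λ.fin Λ.f)
    · right
      have hne : Λ.fin Λ.f ≠ Λ.fin Λ.c := fun h => by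
        have := congrArg Fin.val h
        obtain ⟨hccs, -, hfcs, -⟩ := Λ.lt_cs_facts
        have h1 := Λ.c_lt_n₁; have h2 := Λ.f_lt_n₁; have h3 := Λ.n₁_le_Wd
        rw [fin, fin, val_finOf_of_lt _ (by omega), val_finOf_of_lt _ (by omega)] at this
        unfold c f at this; omega
      have h0 : Λ.ψJ d (Function.update w (Λ.fin Λ.c) true) = 0 :=
        Λ.ψJ_apply_eq_zero d _ (Or.inr (by rw [Function.update_of_ne hne]; exact hf))
      have := Λ.norm_read_apply (Λ.ψJ d) (fun w hw => Λ.ψJ_apply_eq_zero d w (Or.inl hw)) w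
      rw [← Λ.junkVec_eq, h0, norm_zero, mul_zero] at this
      exact norm_eq_zero.1 this
    · left; exact Λ.goodVec_apply_eq_zero hd w hf
  unfold Pb
  simp_rw [hsplit, Finset.sum_add_distrib]
  rw [Λ.junk_symm d T, Λ.sum_good hd, Λ.sum_good hd, add_sub_add_right_eq_sub, ← Finset.sum_sub_distrib]
  refine Finset.sum_congr rfl fun γ _ => ?_
  rw [← Finset.sum_sub_distrib]
  refine Finset.sum_congr rfl fun u _ => ?_
  split_ifs <;> simp

end Layout








end CubicBlock

end VanDamSeroussi

end Literature.Computability.Cryptography
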